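import Mathlib.FieldTheory.IsAlgClosed.AlgebraicClosure
import Mathlib.FieldTheory.AlgebraicClosure
import Mathlib.FieldTheory.Separable
import Mathlib.Algebra.Polynomial.BigOperators
import HarnessLib

/-!
# The conjugates of an algebraic element as an indexed family

Topic: `Literature/AlgebraicGeometry/Resolution` (valued function fields; models of discs over
valuation rings). Bookkeeping for the algebraization step of M. Temkin, *Inseparable local
uniformization*, J. Algebra 373 (2013) = arXiv:0804.1554v3, Thm. 3.3.1, Step 3 (p. 45), in the
ambient rendering of the tree (one algebraically closed field `Ω`, subfields `k ≤ m ≤ Ω`, a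
finite Galois `M|m` inside `m̃ ⊆ Ω`): the `k`-conjugates of `a ∈ Ω` (separable algebraic over
`k`) are the elements of the finite set `S = ((minpoly_k a).aroots Ω).toFinset`, the monic
separable `minpoly_k a` is `∏_{α ∈ S} (X − α)`, so `∏_{α ∈ S} (x − α) = (minpoly_k a)(x)` is a
`k`-RATIONAL function of `x` (the `K`-rational disc function of the conjugate-discs files), and
`Gal(M|m)` permutes the conjugates lying in `M`.

* `prod_X_sub_C_conj_eq`, `prod_sub_conj_eq_aeval`, `self_mem_conj` — PROVED;
* `aeval_coe_eq`, `algEquiv_apply_mem_conj` — `Gal(M|m)` (`k ≤ m`) permutes the conjugates in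
  `M` — PROVED.

All statements are [folklore]; no definitions, no named facts.

## Sources

* M. Temkin, arXiv:0804.1554v3, proof of Thm. 3.3.1, Step 3 (p. 45) (the use).
-/

noncomputable section

open scoped BigOperators
open Polynomial

namespace Literature.AlgebraicGeometry.Resolution

namespace ConjugateDiscs

universe u

variable {Ω : Type u} [Field Ω] [DecidableEq Ω] (k : Subfield Ω)

section Split

variable [IsAlgClosed Ω]

/-- **The minimal polynomial is the product over the conjugates**: for `a` separable algebraic
over `k`, `(minpoly_k a) = ∏_{α ∈ S} (X − α)` over `Ω`, `S` the set of its roots in `Ω`.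
[folklore] -/
theorem prod_X_sub_C_conj_eq {a : Ω} (hint : IsIntegral k a) (hsep : IsSeparable k a) :
    ∏ α ∈ ((minpoly k a).aroots Ω).toFinset, (X - C α) = (minpoly k a).map (algebraMap k Ω) := by
  classical
  set p : Ω[X] := (minpoly k a).map (algebraMap k Ω) with hp
  have hpm : p.Monic := (minpoly.monic hint).map _
  have hsplit : p.Splits := IsAlgClosed.splits p
  have hnodup : p.roots.Nodup := nodup_roots (Separable.map hsep)
  have h1 : p = (p.roots.map (X - C ·)).prod := hsplit.eq_prod_roots_of_monic hpm
  conv_rhs => rw [h1]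
  rw [Finset.prod_eq_multiset_prod, Multiset.toFinset_val, hnodup.dedup]

/-- `∏_{α ∈ S} (x − α) = (minpoly_k a)(x)`: the product over the conjugates is `k`-rational in
`x`. [folklore] -/
theorem prod_sub_conj_eq_aeval {a : Ω} (hint : IsIntegral k a) (hsep : IsSeparable k a) (x : Ω) :
    ∏ α ∈ ((minpoly k a).aroots Ω).toFinset, (x - α) = aeval x (minpoly k a) := by
  have h := congrArg (Polynomial.eval x) (prod_X_sub_C_conj_eq k hint hsep)
  rw [eval_prod, eval_map, ← aeval_def] at h
  rw [← h]
  exact Finset.prod_congr rfl fun α _ => by rw [eval_sub, eval_X, eval_C]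

end Split

/-- `a` is one of its conjugates. [folklore] -/
theorem self_mem_conj {a : Ω} (hint : IsIntegral k a) :
    a ∈ ((minpoly k a).aroots Ω).toFinset := by
  rw [Multiset.mem_toFinset, mem_aroots]
  exact ⟨minpoly.ne_zero hint, minpoly.aeval k a⟩

/-- Membership in the set of conjugates is vanishing of the minimal polynomial. [folklore] -/
theorem mem_conj_iff {a : Ω} (hint : IsIntegral k a) {α : Ω} :
    α ∈ ((minpoly k a).aroots Ω).toFinset ↔ aeval α (minpoly k a) = 0 := by
  rw [Multiset.mem_toFinset, mem_aroots]
  exact ⟨fun h => h.2, fun h => ⟨minpoly.ne_zero hint, h⟩⟩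

/-! ### `Gal(M|m)` permutes the conjugates -/

variable {m : Subfield Ω}

omit [DecidableEq Ω] in
/-- Evaluation of a `k`-polynomial at an element of `M ⊆ m̃ ⊆ Ω` computed in `M` (through
`k → m → M`) and in `Ω` agree. [folklore] -/
theorem aeval_coe_eq (hkm : k ≤ m) (M : IntermediateField m (algebraicClosure m Ω)) (z : M)
    (q : k[X]) :
    (((aeval z (q.map (Subfield.inclusion hkm)) : M) : algebraicClosure m Ω) : Ω) =
      aeval (((z : algebraicClosure m Ω) : Ω)) q := by
  set ι : M →+* Ω := (algebraMap (algebraicClosure m Ω) Ω).comp (algebraMap M (algebraicClosure m Ω))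
    with hι
  have hιz : ∀ w : M, ι w = ((w : algebraicClosure m Ω) : Ω) := fun _ => rfl
  rw [← hιz, aeval_def, eval₂_map, hom_eval₂, aeval_def, hιz]
  congr 1

/-- **`Gal(M|m)` permutes the `k`-conjugates** (`k ≤ m`): if `z ∈ M` is a conjugate of `a` then
so is `θ z` for every `θ ∈ Gal(M|m)`. [folklore] -/
theorem algEquiv_apply_mem_conj (hkm : k ≤ m) (M : IntermediateField m (algebraicClosure m Ω)) {a : Ω}
    (hint : IsIntegral k a) (θ : M ≃ₐ[m] M) {z : M}
    (hz : ((z : algebraicClosure m Ω) : Ω) ∈ ((minpoly k a).aroots Ω).toFinset) :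
    (((θ z : M) : algebraicClosure m Ω) : Ω) ∈ ((minpoly k a).aroots Ω).toFinset := by
  rw [mem_conj_iff k hint] at hz ⊢
  set ι : M →+* Ω := (algebraMap (algebraicClosure m Ω) Ω).comp (algebraMap M (algebraicClosure m Ω))
    with hι
  have hιinj : Function.Injective ι := ι.injective
  have h1 : aeval z ((minpoly k a).map (Subfield.inclusion hkm)) = 0 := by
    apply hιinj
    rw [map_zero]
    exact (aeval_coe_eq k hkm M z (minpoly k a)).trans hz
  rw [← aeval_coe_eq k hkm M (θ z) (minpoly k a), aeval_algHom_apply, h1, map_zero]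
  rfl

end ConjugateDiscs

end Literature.AlgebraicGeometry.Resolution

end
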